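import Mathlib.Analysis.SpecialFunctions.Trigonometric.Basic
import Literature.MathematicalPhysics.QuantumFieldTheory.TorusChartCochains
import HarnessLib

/-!
# The discrete curl on a charted torus is `ℓ²`-bounded; the volume-uniform Gaussian vortex cost

Two elementary estimates of the spin-wave / vortex calculus on a charted discrete torus
(`TorusChart.lean`, `TorusChartCochains.lean`), used when a compact abelian lattice model is unfolded
à la Villain / Fröhlich–Spencer into integer bond fields `a` (vortex currents `d₁ a`) and real fields `ψ`:

* `TorusChart.sum_d₁_sq_le` — the coboundary `d₁` (plaquette circulation) has operator norm at most
  `4 √d` on `ℓ²`: `Σ_{x,i,j} (d₁ θ)(x;i,j)² ≤ 16 d · Σ_{x,i} θ(x,i)²` (Cauchy–Schwarz on the four edges of a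
  plaquette and translation invariance of `Σ_x`; the sum runs over ORDERED pairs `(i, j)`, the diagonal
  vanishing).
* `TorusChart.vortexCost_le` — consequently, since `d₁ (2π a − d₀ ψ) = 2π d₁ a` (`d₁ ∘ d₀ = 0`), every
  configuration of an integer `1`-cochain `a` and a real `0`-cochain `ψ` pays, against bond weights
  `c(x,i) ≥ c₀ ≥ 0`, at least the VOLUME-UNIFORM Gaussian vortex cost
  `(π² c₀ / 4d) · Σ_{x,i,j} (d₁ a)(x;i,j)² ≤ Σ_{x,i} c(x,i) (2π a(x,i) − (d₀ ψ)(x,i))²`;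
  in particular this bounds from below the Coulomb (minimal) energy of the vorticity class of `a`.

Everything is proved; no named fact is introduced.

## References

* J. Fröhlich, T. Spencer, Comm. Math. Phys. 81 (1981) 527–602, §3–§4 (spin waves and vortices of the
  Villain / XY model; the Gaussian energy of a vortex configuration). [folklore form]
-/

namespace Literature.MathematicalPhysics.QuantumFieldTheory

open scoped BigOperators

namespace TorusChart

variable {Λ : Type*} [AddCommGroup Λ] {d : ℕ} (F : TorusChart Λ d)

/-- Cauchy–Schwarz for a plaquette circulation: `(a + b - c - e)² ≤ 4 (a² + b² + c² + e²)`. [folklore] -/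
theorem sq_add_sub_sub_le_four_mul (a b c e : ℝ) :
    (a + b - c - e) ^ 2 ≤ 4 * (a ^ 2 + b ^ 2 + c ^ 2 + e ^ 2) := by
  nlinarith [sq_nonneg (a - b), sq_nonneg (a + c), sq_nonneg (a + e), sq_nonneg (b + c), sq_nonneg (b + e),
    sq_nonneg (c - e)]

/-- Pointwise bound of a plaquette circulation by its four edges. [folklore] -/
theorem d₁_sq_le (θ : Λ → Fin d → ℝ) (x : Λ) (i j : Fin d) :
    (F.d₁ θ x i j) ^ 2 ≤
      4 * ((θ x i) ^ 2 + (θ (x + F.gen i) j) ^ 2 + (θ (x + F.gen j) i) ^ 2 + (θ x j) ^ 2) := by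
  rw [d₁_apply]
  exact sq_add_sub_sub_le_four_mul _ _ _ _

/-- A sum over the torus is invariant under translation of the summation variable. [folklore] -/
theorem sum_comp_add_eq {M : Type*} [Fintype Λ] [AddCommMonoid M] (g : Λ → M) (v : Λ) :
    ∑ x, g (x + v) = ∑ x, g x :=
  Fintype.sum_equiv (Equiv.addRight v) _ _ fun _ => rfl

/-- **The discrete curl is `ℓ²`-bounded**: on a finite charted torus,
`Σ_{x,i,j} (d₁ θ)(x;i,j)² ≤ 16 d · Σ_{x,i} θ(x,i)²` (ordered pairs `(i,j)`). [folklore] -/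
theorem sum_d₁_sq_le [Fintype Λ] (θ : Λ → Fin d → ℝ) :
    ∑ x, ∑ i, ∑ j, (F.d₁ θ x i j) ^ 2 ≤ 16 * d * ∑ x, ∑ i, (θ x i) ^ 2 := by
  have hsw : ∀ g : Λ → Fin d → Fin d → ℝ,
      ∑ x, ∑ i, ∑ j, g x i j = ∑ i, ∑ j, ∑ x, g x i j := fun g => by
    rw [Finset.sum_comm]
    exact Finset.sum_congr rfl fun i _ => Finset.sum_comm
  have hrhs : ∑ x, ∑ i, (θ x i) ^ 2 = ∑ i, ∑ x, (θ x i) ^ 2 := Finset.sum_comm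
  have hd : (Fintype.card (Fin d) : ℝ) = d := by rw [Fintype.card_fin]
  calc ∑ x, ∑ i, ∑ j, (F.d₁ θ x i j) ^ 2
      ≤ ∑ x, ∑ i, ∑ j,
          4 * ((θ x i) ^ 2 + (θ (x + F.gen i) j) ^ 2 + (θ (x + F.gen j) i) ^ 2 + (θ x j) ^ 2) := by
        gcongr with x _ i _ j _
        exact F.d₁_sq_le θ x i j
    _ = ∑ i : Fin d, ∑ j : Fin d, (8 * ∑ x, (θ x i) ^ 2 + 8 * ∑ x, (θ x j) ^ 2) := by
        rw [hsw]
        refine Finset.sum_congr rfl fun i _ => Finset.sum_congr rfl fun j _ => ?_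
        rw [← Finset.mul_sum, Finset.sum_add_distrib, Finset.sum_add_distrib, Finset.sum_add_distrib,
          sum_comp_add_eq (fun y => (θ y j) ^ 2) (F.gen i),
          sum_comp_add_eq (fun y => (θ y i) ^ 2) (F.gen j)]
        ring
    _ = ∑ i : Fin d, (8 * d * ∑ x, (θ x i) ^ 2 + 8 * ∑ j, ∑ x, (θ x j) ^ 2) := by
        refine Finset.sum_congr rfl fun i _ => ?_
        rw [Finset.sum_add_distrib, Finset.sum_const, Finset.card_univ, nsmul_eq_mul, hd,
          ← Finset.mul_sum]
        ring
    _ = 16 * d * ∑ i, ∑ x, (θ x i) ^ 2 := by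
        rw [Finset.sum_add_distrib, Finset.sum_const, Finset.card_univ, nsmul_eq_mul, hd,
          ← Finset.mul_sum]
        ring
    _ = 16 * d * ∑ x, ∑ i, (θ x i) ^ 2 := by rw [hrhs]

/-- The curl of `2π a − d₀ ψ` is `2π` times the (integer) curl of `a`. [folklore] -/
theorem d₁_two_pi_mul_intCast_sub_d₀ (a : Λ → Fin d → ℤ) (ψ : Λ → ℝ) (x : Λ) (i j : Fin d) :
    F.d₁ (fun y k => 2 * Real.pi * (a y k : ℝ) - F.d₀ ψ y k) x i j =
      2 * Real.pi * ((F.d₁ a x i j : ℤ) : ℝ) := by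
  have h0 : F.d₁ (F.d₀ ψ) x i j = 0 := by rw [F.d₁_d₀]; rfl
  rw [d₁_apply] at h0 ⊢
  rw [d₁_apply]
  push_cast
  linear_combination (-1 : ℝ) * h0

/-- **The volume-uniform Gaussian vortex cost.** For an integer `1`-cochain `a` (bond integers of the
Villain / lift), a real `0`-cochain `ψ` and bond weights `c(x,i) ≥ c₀ ≥ 0` on a finite charted torus with
`d` directions,
`(π² c₀ / 4d) · Σ_{x,i,j} (d₁ a)(x;i,j)² ≤ Σ_{x,i} c(x,i) · (2π a(x,i) − (d₀ ψ)(x,i))²`. [folklore] -/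
theorem vortexCost_le [Fintype Λ] (a : Λ → Fin d → ℤ) (ψ : Λ → ℝ) (c : Λ → Fin d → ℝ) {c₀ : ℝ}
    (hc₀ : 0 ≤ c₀) (hc : ∀ x i, c₀ ≤ c x i) :
    Real.pi ^ 2 * c₀ / (4 * d) * ∑ x, ∑ i, ∑ j, ((F.d₁ a x i j : ℤ) : ℝ) ^ 2 ≤
      ∑ x, ∑ i, c x i * (2 * Real.pi * (a x i : ℝ) - F.d₀ ψ x i) ^ 2 := by
  set θ : Λ → Fin d → ℝ := fun y k => 2 * Real.pi * (a y k : ℝ) - F.d₀ ψ y k with hθ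
  have hθ0 : 0 ≤ ∑ x, ∑ i, (θ x i) ^ 2 :=
    Finset.sum_nonneg fun _ _ => Finset.sum_nonneg fun _ _ => sq_nonneg _
  have hrhs : c₀ * ∑ x, ∑ i, (θ x i) ^ 2 ≤
      ∑ x, ∑ i, c x i * (2 * Real.pi * (a x i : ℝ) - F.d₀ ψ x i) ^ 2 := by
    rw [Finset.mul_sum]
    refine Finset.sum_le_sum fun x _ => ?_
    rw [Finset.mul_sum]
    exact Finset.sum_le_sum fun i _ => mul_le_mul_of_nonneg_right (hc x i) (sq_nonneg _)
  have hcurl : ∑ x, ∑ i, ∑ j, (F.d₁ θ x i j) ^ 2 =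
      4 * Real.pi ^ 2 * ∑ x, ∑ i, ∑ j, ((F.d₁ a x i j : ℤ) : ℝ) ^ 2 := by
    rw [Finset.mul_sum]
    refine Finset.sum_congr rfl fun x _ => ?_
    rw [Finset.mul_sum]
    refine Finset.sum_congr rfl fun i _ => ?_
    rw [Finset.mul_sum]
    refine Finset.sum_congr rfl fun j _ => ?_
    rw [hθ, F.d₁_two_pi_mul_intCast_sub_d₀]
    ring
  have hmain := F.sum_d₁_sq_le θ
  rcases Nat.eq_zero_or_pos d with hd | hd
  · -- no directions: the left-hand side is `0`
    subst hd
    have h0 : Real.pi ^ 2 * c₀ / (4 * ((0 : ℕ) : ℝ)) = 0 := by simp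
    rw [h0, zero_mul]
    exact le_trans (mul_nonneg hc₀ hθ0) hrhs
  · have hdpos : (0 : ℝ) < d := Nat.cast_pos.2 hd
    calc Real.pi ^ 2 * c₀ / (4 * d) * ∑ x, ∑ i, ∑ j, ((F.d₁ a x i j : ℤ) : ℝ) ^ 2
        = c₀ / (16 * d) * ∑ x, ∑ i, ∑ j, (F.d₁ θ x i j) ^ 2 := by
          rw [hcurl]; field_simp; ring
      _ ≤ c₀ / (16 * d) * (16 * d * ∑ x, ∑ i, (θ x i) ^ 2) := by gcongr
      _ = c₀ * ∑ x, ∑ i, (θ x i) ^ 2 := by field_simp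
      _ ≤ _ := hrhs

end TorusChart

end Literature.MathematicalPhysics.QuantumFieldTheory
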